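import Summits.QuantumFields.YangMills.Theorems.BalabanUVNodesN11SupplyChainFirstLink

/-!
# DAG node N11 — THE LEVEL-0 CONSTANT IS RIGID: any two exposed witnesses of `ρ₀`'s §2 form have the SAME constants (`= E(p)`), so the chain's base constant is
# `E(p)` for EVERY `θ`, the level-0 no-expansion clause TRANSFERS to the chain's base witness, and THE FIRST LINK ALONE closes the chain's level 1 at the door of record

HEADER — WORK-UNIT METADATA.  Cell `pub-ymgap`, YM-PLAN Track A (HUMAN RULING D-0062 ∕ D-0149 width push), seat `pub-ymgap-dag-n08-w2` (g2; WIDTH SEAT re-pointed to N11's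
§3-supply residue, DEDUP-354∕355), route `BalabanUVNodes` rev 25 (v1.7 `CoPH` key), item K1⁷ `StabilityBAtRecordR13SepCoPH` = stmt-QuantumFields-20542; PROOF lane
(`--supports 20542 --as helper`), count-neutral.  [III] = [Balaban1988Convergent], [I] = [Balaban1987RG1].  Over this seat's `…SupplyChainFirstLink` (p597418:
`FirstLinkObligations`, `.chainFormAt_one`), dag-n11-e's `…Sect3SupplyChainDefs ∕ …ObligationsDefs ∕ …NoExpansionTruncatedWitness ∕ …ThmP245OfSect3SupplyCoPH` (`baseWitness`,
`chainWitness`, `NoExpansionClauseFor`, `ChainFormAt`, `sect2Slot_succ_congr_of_agree_of_Omega_empty`, `noExpansionTStepAt_rePinH_doorCured_theta13LiveOfRecord_zero`) and def-T v1.7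
(`Node00.Record13CoPH`: `HasSect2FormAtZS`, `sLaw₁₃CoPH_zero`; 11a `TkOfRecord_zero`; `B16Thm1BaseAtRecord11`: `action23_zero`, `wilsonLocal_sect2ActionDataOfRecord`, `fst_baseCfg_zero`).

WHY THIS FILE.  Two things in N11's chain road are hidden behind `∃`: def-T's level-0 witness (dag-n11-e's `baseWitness θ p` READS it by `Classical.choose` — dag-n11-w1's
(Q1) «BASE WITNESS IS OPAQUE», INBOX 2026-08-28T01:44Z) and dag-n11-d's no-expansion deliverable `NoExpansionTStepAt θ p k` («for SOME exposed witness of `ρ_k`'s form the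
𝐓-clause holds»), whereas the chain's `NoExpansionObligation` asks the clause FOR THE CHAIN's witness.  AT LEVEL 0 BOTH GAPS CLOSE BY RIGIDITY: at length 0 the 𝐓-operation is
the identity (11a `TkOfRecord_zero`) and (2.23) has no term sums (`action23_zero`), so the slot `𝐓₀ exp A₀[t, E]` reads NO term values and the constant factors out,
`sect2Slot … s₀ t E U = e^{−E} · sect2Slot … s₀ t′ 0 U` (§1); the form clause `ρ₀ = 𝐓₀ exp A₀[t, E_0]` a.e. (`χ₀ ≡ 1`, `ρ₀ ≢ 0`, product Haar a probability measure) then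
PINS the constant: any two exposed witnesses have `E_0 = E_0′`, `= E(p)` by def-T's explicit base (§2) — in particular `(baseWitness θ p).2 = E(p)` for EVERY v1.7 `θ`.  At a
NO-expansion history of length 1 the slot `𝐓₁ exp A₁[t, E]` reads no term values either (levels `≤ 0` by dag-n11-e's `…_of_Omega_empty`, levels `≥ 1` by this seat's
`sect2Slot_graftAbove_zero`), so the level-0 no-expansion clause TRANSFERS between exposed witnesses, hence from dag-n11-d's `NoExpansionTStepAt θ p 0` TO THE CHAIN's BASE (§3).
Consequence (§4): the chain's level-1 INDUCTIVE HYPOTHESIS `ChainFormAt θ p σ 1` — what the level-1 obligations of `SupplierObligations` consume — from the FIRST LINK and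
`NoExpansionTStepAt θ p 0` on the live-selector line, and at the re-pinned door of K0a's cured witness of record from THE FIRST LINK ALONE (`0 < K`).

WHAT THIS FILE PROVES (theorems only; 0 `sorry`, standard axioms).
§1 `sect2Slot_zero_eq_exp_mul` (length 0: the constant factors out, no term values read) · `sect2Slot_zero_pos`.
§2 `snd_eq_of_hasSect2FormAtZS_zero` (two exposed level-0 witnesses have equal constants) · `hasSect2FormAtZS_zero_explicit` (def-T's explicit base `(0, E(p))`, adapted from
   `hasSect2FormAEZS_zero_of_bg_readsScaleZero`) · ★ `snd_eq_EOfRecord_of_hasSect2FormAtZS_zero` · ★★ `baseWitness_snd` ∕ `chainWitness_zero_snd`.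
§3 `sect2Slot_one_irrel_of_Omega_empty` · ★ `noExpansionClauseFor_zero_of_hasForm` · ★★ `noExpansionClauseFor_zero_baseWitness_of_noExpansionTStepAt` (`1 ≤ M`) ·
   `noExpansionObligation_zero_of_noExpansionTStepAt` (the `k = 0` instance of dag-n11-e's `NoExpansionObligation` for ANY supplier).
§4 ★★ `chainFormAt_one_of_firstLink_of_noExpansionTStepAt` ∕ `sLaw₁₃CoPH_one_of_firstLink_of_noExpansionTStepAt` (live-selector line) · ★★★ `chainFormAt_one_rePinH_doorCured_theta13LiveOfRecord_of_firstLink` (at the door: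
   `FirstLinkObligations θᵈ p σ → 0 < p.K → ChainFormAt θᵈ p σ 1`, NOTHING ELSE).
§5 (v1.1) ★ `firstStepClauses_present_of_labels` · ★★ `firstStepSupplyAtLabels_iff_exists_present` (g0's labelled supply = first-step data with the clauses at every 𝐓-present
   pair) · `firstLinkObligations_of_labels` (the first link from DATA in print's indexing); §6 (v1.1) ★ `noExpansionTStepAt_zero_iff_clauseFor_baseWitness`.

HONEST FRAMING.  Count-neutral kernel bookkeeping + one small rigidity computation at level 0; the first link's content ([I] Thm 1 + [II] at def-T's level-1 objects) is NOT
proved for any `θ`; the TERM half of the base witness stays opaque (never read at the levels `≥ 1`); nothing of Bałaban asserted; N11 NOT discharged; K1⁷ NOT closed; counts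
unmoved (typed 28∕28 · discharged 5∕27).  One finite `𝕋⁴_{L^K}` programme at fixed `ε = L^{−K}`; R4 closes only the conditional finite-𝕋⁴ rung `BalabanLadder.UV` — NOT ℝ⁴,
NOT OS, NOT a mass gap, NOT Clay.  No `sorry`, no `axiom`, no `instance`, no `notation`.
Sources (SHAPE only): [III] Thm 1 p.262 («ρ₀ = exp[−(1∕g₀²)A − E], E a normalization constant»), (2.17)–(2.18) p.257, (2.20) p.258, (2.23)–(2.25) pp.258–259, Theorem p.245,
(3.24)–(3.25) p.270, §3 p.279; [I] Thm 1 p.258; [IV] = [Balaban1989LargeFieldI] (0.2)–(0.4) p.176, p.177 (i)–(ii).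
-/

noncomputable section

open MeasureTheory
open scoped BigOperators Matrix.Norms.L2Operator

namespace Summit.QuantumFields.YangMills.Theorems.BalabanUVNodesN11SupplyChainBaseConstant

open Literature.MathematicalPhysics.QuantumFieldTheory.Balaban1983to89 T4Continuum Node00 Node00.Tk
open Literature.MathematicalPhysics.QuantumFieldTheory.Balaban1983to89.B16Thm1BaseAtRecord11 (action23_zero wilsonLocal_sect2ActionDataOfRecord fst_baseCfg_zero wilsonAction_eq_mul)
open Literature.MathematicalPhysics.QuantumFieldTheory.Balaban1983to89.B16RLeafRecord13AtLive
  (kappa_nonneg_theta13LiveOfFamily E0_nonneg_theta13LiveOfFamily B0_nonneg_theta13LiveOfFamily)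
open BalabanUVNodesN11Sect3SupplyDefs (NoExpansionTStepAt)
open BalabanUVNodesN11Sect3SupplySpliceDefs
open BalabanUVNodesN11NoExpansionTruncatedWitness (sect2Slot_succ_congr_of_agree_of_Omega_empty)
open BalabanUVNodesN11Sect3SupplyChainDefs BalabanUVNodesN11Sect3SupplyChainObligationsDefs
open BalabanUVNodesN11FirstStepSupply BalabanUVNodesN11SupplyChainFirstLink
open BalabanUVNodesN11ThmP245OfSect3SupplyCoPH (noExpansionTStepAt_rePinH_doorCured_theta13LiveOfRecord_zero)
open BalabanUVNodesN11RePinnedParamDefs (rePinH provisos₁₃CoPH_rePinH)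

/-! ## §1. At length 0 the §2 slot reads no term values and the constant factors out -/

section LevelZero

variable {F : T4Family} {N : ℕ} [NeZero N]
variable {𝔸 : Type*} [NormedRing 𝔸] [NormedAlgebra ℂ 𝔸] [CompleteSpace 𝔸]
variable {ν : Stage7Numerics} {M : ℕ} {g : ℕ → ℝ} {K : ℕ}
variable (V : Type) [NormedAddCommGroup V] [InnerProductSpace ℝ V] [FiniteDimensional ℝ V] [MeasurableSpace V] [BorelSpace V]

/-- **AT LENGTH 0 THE CONSTANT FACTORS OUT OF THE §2 SLOT AND NO TERM VALUE IS READ**: `𝐓₀ exp A₀[t, E] (V₀) = e^{−E} · 𝐓₀ exp A₀[t′, 0] (V₀)` for ANY term values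
`t, t′` — 11a's `k = 0` face `𝐓₀ = 1` (`TkOfRecord_zero`) and (2.23) at `k = 0`, `A₀ = −A(1∕g₀²(·), ·) − E` (`action23_zero`).
[cite: Balaban1988Convergent, Thm 1 p.262, (2.18) p.257, (2.20) p.258, (2.23)–(2.24) pp.258–259] -/
theorem sect2Slot_zero_eq_exp_mul (S : Sect2.Setting 𝔸 (SU N)) (Rz : Sect2.Residual (F.P K) 𝔸) (W : TkWeights F N V K)
    (s₀ : SeqOfRecord F ν M g K 0) (t t' : Sect2.TermValues (F.P K) 𝔸 V M) (E : ℝ) (U : BgMap F N K) (V₀ : GaugeField (F.P K) 0 (SU N)) :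
    sect2Slot F N V K S Rz W s₀ t E U V₀ = Real.exp (-E) * sect2Slot F N V K S Rz W s₀ t' 0 U V₀ := by
  have hw : ∀ (u : Sect2.TermValues (F.P K) 𝔸 V M) (a : Tk.SFluct (F.P K) V) (e : ℝ),
      (sect2ActionDataOfRecord F N V K S Rz s₀ u a e).wilsonLocal = B14.Eq225Concrete.smearedWilson (B14.LocalCoupling.invSq S.flow Rz.phi 0) :=
    fun u a e => (wilsonLocal_sect2ActionDataOfRecord F N V K S Rz s₀ u a e).1
  have hc : ∀ (u : Sect2.TermValues (F.P K) 𝔸 V M) (a : Tk.SFluct (F.P K) V) (e : ℝ), (sect2ActionDataOfRecord F N V K S Rz s₀ u a e).Econst = e :=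
    fun u a e => (wilsonLocal_sect2ActionDataOfRecord F N V K S Rz s₀ u a e).2
  simp only [sect2Slot, TkOfRecord_zero, sect2Operand, action23_zero, hw, hc, sub_zero, ← Real.exp_add]
  congr 1
  ring

/-- At length 0 the §2 slot is positive (an exponential: `𝐓₀ = 1`). [cite: Balaban1988Convergent, (2.18) p.257, (2.20) p.258 (bookkeeping)] -/
theorem sect2Slot_zero_pos (S : Sect2.Setting 𝔸 (SU N)) (Rz : Sect2.Residual (F.P K) 𝔸) (W : TkWeights F N V K)
    (s₀ : SeqOfRecord F ν M g K 0) (t : Sect2.TermValues (F.P K) 𝔸 V M) (E : ℝ) (U : BgMap F N K) (V₀ : GaugeField (F.P K) 0 (SU N)) :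
    0 < sect2Slot F N V K S Rz W s₀ t E U V₀ := by
  simp only [sect2Slot, TkOfRecord_zero]
  exact sect2Operand_pos _ _ _ _ _ _ _ _ _

/-- **AT A NO-EXPANSION HISTORY OF LENGTH 1 THE §2 SLOT READS NO TERM VALUES** (`1 ≤ M`): `𝐓₁(s) exp A₁(s)[t₁, E] = 𝐓₁(s) exp A₁(s)[t₂, E]` for ANY `t₁, t₂` — the levels
`≤ 0` are not read at a child with `Ω₁ = ∅` (dag-n11-e's `sect2Slot_succ_congr_of_agree_of_Omega_empty`), the level `1` is not read by a graft above `0` (this seat's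
`sect2Slot_graftAbove_zero`): pass through `graftAbove 0 t₁ t₂`. [cite: Balaban1988Convergent, (3.25) p.270, (2.23)–(2.25) pp.258–259, §2 p.262] -/
theorem sect2Slot_one_irrel_of_Omega_empty (hM : 1 ≤ M) (S : Sect2.Setting 𝔸 (SU N)) (Rz : Sect2.Residual (F.P K) 𝔸) (W : TkWeights F N V K)
    (s : SeqOfRecord F ν M g K 1) (hΩ : s.Ω 1 = ∅) (t₁ t₂ : Sect2.TermValues (F.P K) 𝔸 V M) (E : ℝ) (U : BgMap F N K) :
    sect2Slot F N V K S Rz W s t₁ E U = sect2Slot F N V K S Rz W s t₂ E U :=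
  (sect2Slot_succ_congr_of_agree_of_Omega_empty V S Rz W hM (k := 0) s hΩ (t := t₁) (t' := graftAbove 0 t₁ t₂)
      (fun _ hj X z gc φ => graftAbove_E_of_le t₁ t₂ hj X z gc φ) (fun _ hj X φ => graftAbove_R_of_le t₁ t₂ hj X φ)
      (fun _ hj X φ a => graftAbove_B_of_le t₁ t₂ hj X φ a) E U).symm.trans
    (sect2Slot_graftAbove_zero V S Rz W s t₁ t₂ E U)

end LevelZero

/-! ## §2. The level-0 constant of an exposed witness is `E(p)`; the chain's base constant -/

section Constant

variable {F : T4Family} {N : ℕ} [NeZero N]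
variable (θ : Stage13HParams F N) (p : B12.RunParams)

/-- **TWO EXPOSED WITNESSES OF `ρ₀`'s §2 FORM HAVE THE SAME CONSTANTS.**  At the (unique) history `s₀` of length 0 both identities `ρ₀ = 𝐓₀ exp A₀[t, E_0]`,
`ρ₀ = 𝐓₀ exp A₀[t′, E_0′]` hold a.e. (`χ₀ ≡ 1`; `ρ₀ ≢ 0` kills the zero disjunct, `slotsOfRecord₁₃H_zero_ne_zero`); by §1 `e^{−E_0}·G = e^{−E_0′}·G` a.e. with `G > 0`, and product
Haar is a probability measure. [cite: Balaban1988Convergent, Thm 1 p.262, (2.17)–(2.18) p.257, (2.23) p.258] -/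
theorem snd_eq_of_hasSect2FormAtZS_zero
    {t t' : SeqOfRecord F θ.ν θ.τ9.M (gOfRecord₁₃ F N θ.toStage13Params p) p.K 0 → Sect2.TermValues (F.P p.K) (MatA N) (FluctV N) θ.τ9.M}
    {Ek Ek' : SeqOfRecord F θ.ν θ.τ9.M (gOfRecord₁₃ F N θ.toStage13Params p) p.K 0 → ℝ}
    (h : HasSect2FormAtZS F N (FluctV N) p.K (settingOfRecord₁₃ F N θ.toStage13Params p) 0 (θ.rzAt p) (WtOfRecord₁₃H F N θ p) (UbgOfRecord₁₃CoP F N θ.toStage13Params p 0)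
      (fun s u => Sect2.LawsRT (sect2TowerOfRecord F N (FluctV N) p.K (settingOfRecord₁₃ F N θ.toStage13Params p) (θ.rzAt p s) s u) (settingOfRecord₁₃ F N θ.toStage13Params p).lf 0)
      (slotsOfRecord F N θ.ν θ.τ9 (EOfRecord₁₃ F N θ.toStage13Params) (wOfRecord₉ F N θ.toStage9Params) θ.ppSel p (gOfRecord₁₃ F N θ.toStage13Params p) 0) t Ek)
    (h' : HasSect2FormAtZS F N (FluctV N) p.K (settingOfRecord₁₃ F N θ.toStage13Params p) 0 (θ.rzAt p) (WtOfRecord₁₃H F N θ p) (UbgOfRecord₁₃CoP F N θ.toStage13Params p 0)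
      (fun s u => Sect2.LawsRT (sect2TowerOfRecord F N (FluctV N) p.K (settingOfRecord₁₃ F N θ.toStage13Params p) (θ.rzAt p s) s u) (settingOfRecord₁₃ F N θ.toStage13Params p).lf 0)
      (slotsOfRecord F N θ.ν θ.τ9 (EOfRecord₁₃ F N θ.toStage13Params) (wOfRecord₉ F N θ.toStage9Params) θ.ppSel p (gOfRecord₁₃ F N θ.toStage13Params p) 0) t' Ek') :
    Ek = Ek' := by
  funext s₀
  haveI : IsProbabilityMeasure (fieldMeasure (F.P p.K) 0 (SU N)) := Missing.isProbabilityMeasure_fieldMeasure (F.P p.K) 0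
  have hne := slotsOfRecord₁₃H_zero_ne_zero θ p s₀
  have hev : ∀ᵐ V₀ ∂fieldMeasure (F.P p.K) 0 (SU N), Ek s₀ = Ek' s₀ := by
    filter_upwards [(h.2 s₀).2.resolve_left hne, (h'.2 s₀).2.resolve_left hne] with V₀ hV hV'
    have hχ : chiSeqOfRecord F N θ.ν θ.τ9.M (gOfRecord₁₃ F N θ.toStage13Params p) p.K 0 s₀ V₀ ≠ 0 := by
      rw [chiSeqOfRecord_zero]; exact one_ne_zero
    have heq := (hV hχ).symm.trans (hV' hχ)
    rw [sect2Slot_zero_eq_exp_mul (FluctV N) _ _ _ s₀ (t s₀) Sect2.TermValues.zero (Ek s₀),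
      sect2Slot_zero_eq_exp_mul (FluctV N) _ _ _ s₀ (t' s₀) Sect2.TermValues.zero (Ek' s₀)] at heq
    have hpos := sect2Slot_zero_pos (FluctV N) (settingOfRecord₁₃ F N θ.toStage13Params p) (θ.rzAt p s₀) (WtOfRecord₁₃H F N θ p s₀) s₀
      Sect2.TermValues.zero 0 (UbgOfRecord₁₃CoP F N θ.toStage13Params p 0 s₀) V₀
    exact neg_injective (Real.exp_eq_exp.mp (mul_right_cancel₀ hpos.ne' heq))
  obtain ⟨_, hV⟩ := hev.exists
  exact hV

/-- **def-T's EXPLICIT LEVEL-0 WITNESS** — zero term values and the constant `E(p)` of the run — HAS `ρ₀`'s §2 form at every v1.7 `θ` (the proof of def-T's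
`hasSect2FormAEZS_zero_of_bg_readsScaleZero`, whose statement hides the witness behind `∃`, re-run at the objects of record: `𝐓₀ = 1`, `A₀ = −(1∕g₀²)A − E`,
`ρ₀ = e^{−E} exp[−(1∕g₀²)A]`). [cite: Balaban1988Convergent, Thm 1 p.262, (2.18) p.257, (2.23)–(2.24) pp.258–259] -/
theorem hasSect2FormAtZS_zero_explicit :
    HasSect2FormAtZS F N (FluctV N) p.K (settingOfRecord₁₃ F N θ.toStage13Params p) 0 (θ.rzAt p) (WtOfRecord₁₃H F N θ p) (UbgOfRecord₁₃CoP F N θ.toStage13Params p 0)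
      (fun s u => Sect2.LawsRT (sect2TowerOfRecord F N (FluctV N) p.K (settingOfRecord₁₃ F N θ.toStage13Params p) (θ.rzAt p s) s u) (settingOfRecord₁₃ F N θ.toStage13Params p).lf 0)
      (slotsOfRecord F N θ.ν θ.τ9 (EOfRecord₁₃ F N θ.toStage13Params) (wOfRecord₉ F N θ.toStage9Params) θ.ppSel p (gOfRecord₁₃ F N θ.toStage13Params p) 0)
      (fun _ => Sect2.TermValues.zero) (fun _ => EOfRecord₁₃ F N θ.toStage13Params p) := by
  -- adapted from def-T's `Node00.Record13CoPH.hasSect2FormAEZS_zero_of_bg_readsScaleZero` (same computation, witness exposed)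
  refine ⟨Sect2.universalE_const _, fun s => ⟨Sect2.LawsRT.zero _ _, Or.inr (Filter.Eventually.of_forall fun V₀ _ => ?_)⟩⟩
  have hU : ∀ W, UbgOfRecord₁₃CoP F N θ.toStage13Params p 0 s W = W 0 := fun _ => rfl
  have hflow : (settingOfRecord₁₃ F N θ.toStage13Params p).flow.g 0 = gOfRecord₁₃ F N θ.toStage13Params p 0 := rfl
  rw [show slotsOfRecord F N θ.ν θ.τ9 (EOfRecord₁₃ F N θ.toStage13Params) (wOfRecord₉ F N θ.toStage9Params) θ.ppSel p (gOfRecord₁₃ F N θ.toStage13Params p) 0 s V₀ =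
    rhoZeroOfRecord F N p.K (gOfRecord₁₃ F N θ.toStage13Params p 0) (EOfRecord₁₃ F N θ.toStage13Params p) V₀ from rfl]
  simp only [sect2Slot, TkOfRecord_zero, sect2Operand, Tk.baseCfg_snd, hU, fst_baseCfg_zero, action23_zero,
    (wilsonLocal_sect2ActionDataOfRecord F N (FluctV N) p.K _ _ s _ _ _).1, (wilsonLocal_sect2ActionDataOfRecord F N (FluctV N) p.K _ _ s _ _ _).2]
  rw [show B14.LocalCoupling.invSq (settingOfRecord₁₃ F N θ.toStage13Params p).flow (θ.rzAt p s).phi 0 =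
      fun _ => 1 / ((settingOfRecord₁₃ F N θ.toStage13Params p).flow.g 0) ^ 2 from rfl, hflow]
  rw [B14.Eq225Concrete.smearedWilson_const, wilsonAction_eq_mul, rhoZeroOfRecord, Missing.boltzmann, ← Real.exp_add]
  congr 1
  rw [inv_pow, one_div]
  ring

variable {θ p}

/-- ★ **THE CONSTANT OF ANY EXPOSED WITNESS OF `ρ₀`'s §2 FORM IS `E(p)`** at every history of length 0. [cite: Balaban1988Convergent, Thm 1 p.262, (2.18) p.257, (2.23) p.258] -/
theorem snd_eq_EOfRecord_of_hasSect2FormAtZS_zero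
    {t : SeqOfRecord F θ.ν θ.τ9.M (gOfRecord₁₃ F N θ.toStage13Params p) p.K 0 → Sect2.TermValues (F.P p.K) (MatA N) (FluctV N) θ.τ9.M}
    {Ek : SeqOfRecord F θ.ν θ.τ9.M (gOfRecord₁₃ F N θ.toStage13Params p) p.K 0 → ℝ}
    (h : HasSect2FormAtZS F N (FluctV N) p.K (settingOfRecord₁₃ F N θ.toStage13Params p) 0 (θ.rzAt p) (WtOfRecord₁₃H F N θ p) (UbgOfRecord₁₃CoP F N θ.toStage13Params p 0)
      (fun s u => Sect2.LawsRT (sect2TowerOfRecord F N (FluctV N) p.K (settingOfRecord₁₃ F N θ.toStage13Params p) (θ.rzAt p s) s u) (settingOfRecord₁₃ F N θ.toStage13Params p).lf 0)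
      (slotsOfRecord F N θ.ν θ.τ9 (EOfRecord₁₃ F N θ.toStage13Params) (wOfRecord₉ F N θ.toStage9Params) θ.ppSel p (gOfRecord₁₃ F N θ.toStage13Params p) 0) t Ek) :
    Ek = fun _ => EOfRecord₁₃ F N θ.toStage13Params p :=
  snd_eq_of_hasSect2FormAtZS_zero θ p h (hasSect2FormAtZS_zero_explicit θ p)

variable (θ p)

/-- ★★ **THE CHAIN's BASE CONSTANT IS `E(p)` FOR EVERY v1.7 `θ`**: `(baseWitness θ p).2 = fun _ => E(p)` — the constant half of dag-n11-w1's (Q1) «the base witness is opaque»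
closes by rigidity (the term half stays chosen but is never read at the levels `≥ 1`). [cite: Balaban1988Convergent, Thm 1 p.262, (2.18) p.257, (2.23) p.258] -/
theorem baseWitness_snd : (baseWitness θ p).2 = fun _ => EOfRecord₁₃ F N θ.toStage13Params p :=
  snd_eq_EOfRecord_of_hasSect2FormAtZS_zero (baseWitness_form θ p)

/-- … hence the chain's level-0 constant, for every supplier `σ`. [cite: Balaban1988Convergent, Thm 1 p.262 (bookkeeping)] -/
theorem chainWitness_zero_snd (σ : Sect3Supplier θ p) : (chainWitness θ p σ 0).2 = fun _ => EOfRecord₁₃ F N θ.toStage13Params p :=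
  baseWitness_snd θ p

end Constant

/-! ## §3. The level-0 no-expansion clause transfers between exposed witnesses — hence to the chain's base -/

section Transfer

variable {F : T4Family} {N : ℕ} [NeZero N]
variable (θ : Stage13HParams F N) (p : B12.RunParams)

/-- ★ **THE LEVEL-0 NO-EXPANSION CLAUSE TRANSFERS BETWEEN EXPOSED WITNESSES OF `ρ₀`'s §2 FORM** (`1 ≤ M`): the constants agree (§2) and at a no-expansion history of length 1
the slot reads no term values (§1). [cite: Balaban1988Convergent, Theorem p.245, (3.24)–(3.25) p.270, (2.17)–(2.18) p.257] -/
theorem noExpansionClauseFor_zero_of_hasForm (hM : 1 ≤ θ.τ9.M)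
    {t t' : SeqOfRecord F θ.ν θ.τ9.M (gOfRecord₁₃ F N θ.toStage13Params p) p.K 0 → Sect2.TermValues (F.P p.K) (MatA N) (FluctV N) θ.τ9.M}
    {Ek Ek' : SeqOfRecord F θ.ν θ.τ9.M (gOfRecord₁₃ F N θ.toStage13Params p) p.K 0 → ℝ}
    (hform : HasSect2FormAtZS F N (FluctV N) p.K (settingOfRecord₁₃ F N θ.toStage13Params p) 0 (θ.rzAt p) (WtOfRecord₁₃H F N θ p) (UbgOfRecord₁₃CoP F N θ.toStage13Params p 0)
      (fun s u => Sect2.LawsRT (sect2TowerOfRecord F N (FluctV N) p.K (settingOfRecord₁₃ F N θ.toStage13Params p) (θ.rzAt p s) s u) (settingOfRecord₁₃ F N θ.toStage13Params p).lf 0)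
      (slotsOfRecord F N θ.ν θ.τ9 (EOfRecord₁₃ F N θ.toStage13Params) (wOfRecord₉ F N θ.toStage9Params) θ.ppSel p (gOfRecord₁₃ F N θ.toStage13Params p) 0) t Ek)
    (hform' : HasSect2FormAtZS F N (FluctV N) p.K (settingOfRecord₁₃ F N θ.toStage13Params p) 0 (θ.rzAt p) (WtOfRecord₁₃H F N θ p) (UbgOfRecord₁₃CoP F N θ.toStage13Params p 0)
      (fun s u => Sect2.LawsRT (sect2TowerOfRecord F N (FluctV N) p.K (settingOfRecord₁₃ F N θ.toStage13Params p) (θ.rzAt p s) s u) (settingOfRecord₁₃ F N θ.toStage13Params p).lf 0)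
      (slotsOfRecord F N θ.ν θ.τ9 (EOfRecord₁₃ F N θ.toStage13Params) (wOfRecord₉ F N θ.toStage9Params) θ.ppSel p (gOfRecord₁₃ F N θ.toStage13Params p) 0) t' Ek')
    (h : NoExpansionClauseFor θ p 0 t Ek) : NoExpansionClauseFor θ p 0 t' Ek' := by
  have hE : Ek' = Ek := snd_eq_of_hasSect2FormAtZS_zero θ p hform' hform
  subst hE
  intro s hΩ
  exact (h s hΩ).imp_right fun hae => hae.mono fun V' hV' hχ => (hV' hχ).trans
    (congrFun (sect2Slot_one_irrel_of_Omega_empty (FluctV N) hM (settingOfRecord₁₃ F N θ.toStage13Params p) (θ.rzAt p s) (WtOfRecord₁₃H F N θ p s) s hΩ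
      (t s.init) (t' s.init) (Ek' s.init) (UbgOfRecord₁₃CoP F N θ.toStage13Params p 1 s)) V')

/-- ★★ **dag-n11-d's `NoExpansionTStepAt θ p 0` GIVES THE LEVEL-0 NO-EXPANSION CLAUSE FOR THE CHAIN's BASE WITNESS** (`1 ≤ M`): their deliverable names SOME exposed witness of
`ρ₀`'s form (available by def-T's `sLaw₁₃CoPH_zero`) carrying the clause; transfer it to `baseWitness θ p` (§3 ★, `baseWitness_form`).
[cite: Balaban1988Convergent, Theorem p.245, Thm 1 p.262, (3.24)–(3.25) p.270, (2.17)–(2.18) p.257] -/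
theorem noExpansionClauseFor_zero_baseWitness_of_noExpansionTStepAt (hM : 1 ≤ θ.τ9.M) (h : NoExpansionTStepAt θ p 0) :
    NoExpansionClauseFor θ p 0 (baseWitness θ p).1 (baseWitness θ p).2 := by
  obtain ⟨t, Ek, hform, hcl⟩ := h (sLaw₁₃CoPH_zero F N θ p)
  exact noExpansionClauseFor_zero_of_hasForm θ p hM hform (baseWitness_form θ p) hcl

/-- **… I.E. THE `k = 0` INSTANCE OF dag-n11-e's `NoExpansionObligation θ p σ` FOR EVERY SUPPLIER `σ`** (the chain's level-0 witness is the base witness, `rfl`).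
[cite: Balaban1988Convergent, Theorem p.245, (3.24)–(3.25) p.270 (bookkeeping)] -/
theorem noExpansionObligation_zero_of_noExpansionTStepAt (hM : 1 ≤ θ.τ9.M) (h : NoExpansionTStepAt θ p 0) (σ : Sect3Supplier θ p) :
    NoExpansionClauseFor θ p 0 (chainWitness θ p σ 0).1 (chainWitness θ p σ 0).2 :=
  noExpansionClauseFor_zero_baseWitness_of_noExpansionTStepAt θ p hM h

end Transfer

/-! ## §4. The first link closes the chain's level 1: on the live-selector line with `NoExpansionTStepAt θ p 0`; at the door of record ALONE -/

section Chain

variable {F : T4Family} {N : ℕ} [NeZero N]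
variable {θ : Stage13HParams F N} {p : B12.RunParams}

/-- ★★ **THE CHAIN's LEVEL-1 INDUCTIVE HYPOTHESIS FROM THE FIRST LINK AND dag-n11-d's LEVEL-0 DELIVERABLE, ON THE LIVE-SELECTOR LINE**: `ChainFormAt θ p σ 1` from
`FirstLinkObligations θ p σ`, `NoExpansionTStepAt θ p 0`, core provisos (row `rstep`), the selector clause, admissibility, `0 ≤ κ, E₀, B₀`, `1 ≤ M`, `0 < K`
(p597418's `FirstLinkObligations.chainFormAt_one` with its displayed clause DISCHARGED by §3 ★★). [cite: Balaban1988Convergent, Thm 1 p.262, Theorem p.245, §2 p.262, (3.24)–(3.25) p.270; Balaban1987RG1, Thm 1 p.258; Balaban1989LargeFieldI, (0.2)–(0.4) p.176, p.177 (i)–(ii)] -/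
theorem chainFormAt_one_of_firstLink_of_noExpansionTStepAt {σ : Sect3Supplier θ p} (h : FirstLinkObligations θ p σ) (hP : θ.Provisos₁₃CoPH F N)
    (hsel : θ.ppSel = ppSelLiveOfRecord F N θ.ν θ.τ9 (EOfRecord₁₃ F N θ.toStage13Params) (wOfRecord₉ F N θ.toStage9Params))
    (hθ : θ.Admissible F N) (hκ : 0 ≤ θ.s2.lf.κ) (hE₀ : 0 ≤ θ.s2.lf.E₀) (hB₀ : 0 ≤ θ.s2.lf.B₀) (hM : 1 ≤ θ.τ9.M) (hK : 0 < p.K)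
    (hT : NoExpansionTStepAt θ p 0) : ChainFormAt θ p σ 1 :=
  h.chainFormAt_one hP hsel hθ hκ hE₀ hB₀ hM hK (noExpansionClauseFor_zero_baseWitness_of_noExpansionTStepAt θ p hM hT)

/-- **… and `SLaw₁₃CoPH θ p 1`** on the same line. [cite: Balaban1988Convergent, Thm 1 p.262, Theorem p.245; Balaban1989LargeFieldI, (0.2)–(0.4) p.176] -/
theorem sLaw₁₃CoPH_one_of_firstLink_of_noExpansionTStepAt {σ : Sect3Supplier θ p} (h : FirstLinkObligations θ p σ) (hP : θ.Provisos₁₃CoPH F N)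
    (hsel : θ.ppSel = ppSelLiveOfRecord F N θ.ν θ.τ9 (EOfRecord₁₃ F N θ.toStage13Params) (wOfRecord₉ F N θ.toStage9Params))
    (hθ : θ.Admissible F N) (hκ : 0 ≤ θ.s2.lf.κ) (hE₀ : 0 ≤ θ.s2.lf.E₀) (hB₀ : 0 ≤ θ.s2.lf.B₀) (hM : 1 ≤ θ.τ9.M) (hK : 0 < p.K)
    (hT : NoExpansionTStepAt θ p 0) : SLaw₁₃CoPH F N θ p 1 :=
  sLaw₁₃CoPH_of_chainFormAt (chainFormAt_one_of_firstLink_of_noExpansionTStepAt h hP hsel hθ hκ hE₀ hB₀ hM hK hT)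

variable (F N)

/-- ★★★ **AT THE RE-PINNED DOOR OF K0a's CURED WITNESS OF RECORD, THE FIRST LINK ALONE CLOSES THE CHAIN's LEVEL 1**: `FirstLinkObligations θᵈ p σ → 0 < K →
ChainFormAt θᵈ p σ 1` — the level-1 INDUCTIVE HYPOTHESIS keyed to the chain's own witness (what the level-1 obligations of dag-n11-e's `SupplierObligations` consume), the
displayed no-expansion clause being dag-n11-e's theorem `noExpansionTStepAt_rePinH_doorCured_theta13LiveOfRecord_zero` transferred to the base (§3), the core provisos def-T's
door provisos re-pinned (`provisos₁₃CoPH_rePinH`), the selector clause `rfl`, admissibility K0a's, the signs and `M = 1` the family's.  The displayed hypothesis IS the first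
renormalization step ([I] Thm 1 + [II]) in the chain's currency. [cite: Balaban1988Convergent, Thm 1 p.262, Theorem p.245, §3 p.279, (3.24)–(3.25) p.270; Balaban1987RG1, Thm 1 p.258; Balaban1989LargeFieldI, (0.3)–(0.4) p.176, p.177 (i)–(ii)] -/
theorem chainFormAt_one_rePinH_doorCured_theta13LiveOfRecord_of_firstLink (p : B12.RunParams) (hK : 0 < p.K)
    {σ : Sect3Supplier (rePinH (Stage13HParams.ofHistoryBlind F N (Stage13RParams.ofCured F N (theta13LiveOfRecord F N)))) p}
    (h : FirstLinkObligations (rePinH (Stage13HParams.ofHistoryBlind F N (Stage13RParams.ofCured F N (theta13LiveOfRecord F N)))) p σ) :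
    ChainFormAt (rePinH (Stage13HParams.ofHistoryBlind F N (Stage13RParams.ofCured F N (theta13LiveOfRecord F N)))) p σ 1 :=
  chainFormAt_one_of_firstLink_of_noExpansionTStepAt h (provisos₁₃CoPH_rePinH (provisos₁₃CoPH_door_theta13LiveOfRecord F N)) rfl (admissible_theta13LiveOfRecord F N)
    (kappa_nonneg_theta13LiveOfFamily F N eps0OfRecord₁₃ (zeta316OfRecord F N (numerics7OfFamily eps0OfRecord₁₃) 1 1) (RzOfRecord F N) (ZtOfRecord F N))
    (E0_nonneg_theta13LiveOfFamily F N eps0OfRecord₁₃ (zeta316OfRecord F N (numerics7OfFamily eps0OfRecord₁₃) 1 1) (RzOfRecord F N) (ZtOfRecord F N))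
    (B0_nonneg_theta13LiveOfFamily F N eps0OfRecord₁₃ (zeta316OfRecord F N (numerics7OfFamily eps0OfRecord₁₃) 1 1) (RzOfRecord F N) (ZtOfRecord F N))
    (le_of_eq rfl) hK (noExpansionTStepAt_rePinH_doorCured_theta13LiveOfRecord_zero F N p hK)

/-- ★★ **… and the chain's level-1 𝐓-image at that door from the first link alone** (`ChainFormTAt θᵈ p σ 0`, `TLaw₁₃CoPH θᵈ p 0`).
[cite: Balaban1988Convergent, Theorem p.245, remark p.262, §3 p.279, (3.24)–(3.25) p.270; Balaban1987RG1, Thm 1 p.258] -/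
theorem chainFormTAt_zero_rePinH_doorCured_theta13LiveOfRecord_of_firstLink (p : B12.RunParams) (hK : 0 < p.K)
    {σ : Sect3Supplier (rePinH (Stage13HParams.ofHistoryBlind F N (Stage13RParams.ofCured F N (theta13LiveOfRecord F N)))) p}
    (h : FirstLinkObligations (rePinH (Stage13HParams.ofHistoryBlind F N (Stage13RParams.ofCured F N (theta13LiveOfRecord F N)))) p σ) :
    ChainFormTAt (rePinH (Stage13HParams.ofHistoryBlind F N (Stage13RParams.ofCured F N (theta13LiveOfRecord F N)))) p σ 0 :=
  h.chainFormTAt_zero (le_of_eq rfl)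
    (B0_nonneg_theta13LiveOfFamily F N eps0OfRecord₁₃ (zeta316OfRecord F N (numerics7OfFamily eps0OfRecord₁₃) 1 1) (RzOfRecord F N) (ZtOfRecord F N))
    (noExpansionClauseFor_zero_baseWitness_of_noExpansionTStepAt _ p (le_of_eq rfl) (noExpansionTStepAt_rePinH_doorCured_theta13LiveOfRecord_zero F N p hK))

end Chain

/-! ## §5 (v1.1). Print's indexing: the first link's (present) field at the LABELLED 𝐓-present children suffices; the chain's level 1 at the door from first-step DATA

v1.1 (same seat, 2026-08-28; APPEND-ONLY — §1–§4 byte-identical to v1 p598267).  At `k = 0` every 𝐓-present pair of length 1 IS a labelled child `σ(s₀, t)` of print's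
first-step decompositions `t = (P₁, Q₁, R₁, S₁)` (dag-n11-e's `B14SeparationOfRecord.exists_label_of_slotsTOfRecord_succ_ne_zero`), so the (present) field of the first
link may be checked at the LABELLED 𝐓-present children only — g0's `FirstStepSupplyAtLabels θ p` IS «∃ (u, E₁) universal in 𝐄 with the first-step clauses at every
𝐓-present expansion pair» — and the first link (hence, §4, the chain's level 1) follows from FIRST-STEP DATA in print's indexing: `(u, E₁)` universal in 𝐄, the four
𝐄-clauses at ONE history, the first-step clauses at the labelled 𝐓-present children. -/

section Labels

open Literature.MathematicalPhysics.QuantumFieldTheory.Balaban1983to89.B14SeparationOfRecord (exists_label_of_slotsTOfRecord_succ_ne_zero)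
open BalabanUVNodesN11FirstStepSupplyLabels

variable {F : T4Family} {N : ℕ} [NeZero N]
variable (θ : Stage13HParams F N) (p : B12.RunParams)

/-- ★ **THE FIRST-STEP CLAUSES AT THE LABELLED 𝐓-PRESENT CHILDREN GIVE THEM AT EVERY 𝐓-PRESENT EXPANSION PAIR** (a present 𝐓-slot at length 1 is produced by the index map
`σOfRecord … 0`, dag-n11-e's `exists_label_of_slotsTOfRecord_succ_ne_zero`; `init (σ s₀ t) = s₀`). [cite: Balaban1988Convergent, §3 pp.264–265, (3.2)–(3.5) p.265, (3.20) p.269, (3.25) p.270] -/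
theorem firstStepClauses_present_of_labels
    (u : SeqOfRecord F θ.ν θ.τ9.M (gOfRecord₁₃ F N θ.toStage13Params p) p.K 1 → Sect2.TermValues (F.P p.K) (MatA N) (FluctV N) θ.τ9.M)
    (E₁ : SeqOfRecord F θ.ν θ.τ9.M (gOfRecord₁₃ F N θ.toStage13Params p) p.K 1 → ℝ)
    (h : ∀ (s₀ : SeqOfRecord F θ.ν θ.τ9.M (gOfRecord₁₃ F N θ.toStage13Params p) p.K 0) (lab : LbOfRecord F θ.ν p (gOfRecord₁₃ F N θ.toStage13Params p) 0),
      (σOfRecord F θ.ν θ.τ9.M p (gOfRecord₁₃ F N θ.toStage13Params p) 0 s₀ lab).Ω 1 ≠ ∅ →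
      slotsTOfRecord F N θ.ν θ.τ9 (EOfRecord₁₃ F N θ.toStage13Params) (wOfRecord₉ F N θ.toStage9Params) θ.ppSel p (gOfRecord₁₃ F N θ.toStage13Params p) 1
          (σOfRecord F θ.ν θ.τ9.M p (gOfRecord₁₃ F N θ.toStage13Params p) 0 s₀ lab) ≠ 0 →
      FirstStepClausesAt θ p (σOfRecord F θ.ν θ.τ9.M p (gOfRecord₁₃ F N θ.toStage13Params p) 0 s₀ lab)
        (u (σOfRecord F θ.ν θ.τ9.M p (gOfRecord₁₃ F N θ.toStage13Params p) 0 s₀ lab)) (E₁ (σOfRecord F θ.ν θ.τ9.M p (gOfRecord₁₃ F N θ.toStage13Params p) 0 s₀ lab)))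
    (s : SeqOfRecord F θ.ν θ.τ9.M (gOfRecord₁₃ F N θ.toStage13Params p) p.K 1) (hΩ : s.Ω 1 ≠ ∅)
    (hT : slotsTOfRecord F N θ.ν θ.τ9 (EOfRecord₁₃ F N θ.toStage13Params) (wOfRecord₉ F N θ.toStage9Params) θ.ppSel p (gOfRecord₁₃ F N θ.toStage13Params p) 1 s ≠ 0) :
    FirstStepClausesAt θ p s (u s) (E₁ s) := by
  obtain ⟨lab, hlab⟩ := exists_label_of_slotsTOfRecord_succ_ne_zero F N θ.ν θ.τ9 (EOfRecord₁₃ F N θ.toStage13Params) θ.ppSel p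
    (gOfRecord₁₃ F N θ.toStage13Params p) 0 θ.A₁ θ.ζ s hT
  have H := h s.init lab
  rw [hlab] at H
  exact H hΩ hT

/-- ★★ **g0's LABELLED FIRST-STEP SUPPLY IS «FIRST-STEP DATA WITH THE CLAUSES AT EVERY 𝐓-PRESENT EXPANSION PAIR»**: `FirstStepSupplyAtLabels θ p ↔ ∃ u E₁, u universal in 𝐄 ∧
∀ s, Ω₁(s) ≠ ∅ → 𝐓ρ₀(s) ≢ 0 → FirstStepClausesAt θ p s (u s) (E₁ s)` — the (present) field of the first link, σ-free (→ by ★ above and the def-T-letter rewriting of g0's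
`slotsTOfRecord₁₃H_one_eq` ∕ `sect2Slot = TkOfRecord ∘ sect2Operand`; ← by restriction to the labelled pairs, as in p597418's `FirstLinkObligations.firstStepSupplyAtLabels`).
[cite: Balaban1988Convergent, §3 pp.264–270, (3.5) p.265, (3.24)–(3.25) p.270, Thm 2 p.263; Balaban1987RG1, Thm 1 p.258] -/
theorem firstStepSupplyAtLabels_iff_exists_present :
    FirstStepSupplyAtLabels θ p ↔
      ∃ (u : SeqOfRecord F θ.ν θ.τ9.M (gOfRecord₁₃ F N θ.toStage13Params p) p.K 1 → Sect2.TermValues (F.P p.K) (MatA N) (FluctV N) θ.τ9.M)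
        (E₁ : SeqOfRecord F θ.ν θ.τ9.M (gOfRecord₁₃ F N θ.toStage13Params p) p.K 1 → ℝ),
        Sect2.UniversalE u ∧
        ∀ s : SeqOfRecord F θ.ν θ.τ9.M (gOfRecord₁₃ F N θ.toStage13Params p) p.K 1, s.Ω 1 ≠ ∅ →
          slotsTOfRecord F N θ.ν θ.τ9 (EOfRecord₁₃ F N θ.toStage13Params) (wOfRecord₉ F N θ.toStage9Params) θ.ppSel p (gOfRecord₁₃ F N θ.toStage13Params p) 1 s ≠ 0 →
            FirstStepClausesAt θ p s (u s) (E₁ s) := by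
  constructor
  · rintro ⟨u, E₁, hu, hx⟩
    refine ⟨u, E₁, hu, firstStepClauses_present_of_labels θ p u E₁ fun s₀ lab hΩ hT => ?_⟩
    have hΩ' : OmegaOfLabel F θ.ν θ.τ9.M p (gOfRecord₁₃ F N θ.toStage13Params p) 0 s₀ lab ≠ ∅ := by
      rw [← σOfRecord_zero_Ω_one]; exact hΩ
    have hT' : (fun V' : GaugeField (F.P p.K) 1 (SU N) =>
        transportOfRecord F N p.K 0 (fun U =>
          wOfRecord₉ F N θ.toStage9Params p (gOfRecord₁₃ F N θ.toStage13Params p) 0 (σOfRecord F θ.ν θ.τ9.M p (gOfRecord₁₃ F N θ.toStage13Params p) 0 s₀ lab) U V' *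
            rhoZeroOfRecord F N p.K (gOfRecord₁₃ F N θ.toStage13Params p 0) (EOfRecord₁₃ F N θ.toStage13Params p) U) V') ≠ 0 := by
      rw [← slotsTOfRecord₁₃H_one_eq θ p]; exact hT
    obtain ⟨hnew, hanE, hanR, hanB, hid⟩ := hx s₀ lab hΩ' hT'
    refine ⟨hnew, hanE, hanR, hanB, Or.inr ?_⟩
    rw [slotsTOfRecord₁₃H_one_eq θ p, sect2Slot_eq_TkOfRecord_sect2Operand]
    exact hid
  · rintro ⟨u, E₁, hu, hp⟩
    refine ⟨u, E₁, hu, fun s₀ lab hΩ hT => ?_⟩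
    have hΩ' : (σOfRecord F θ.ν θ.τ9.M p (gOfRecord₁₃ F N θ.toStage13Params p) 0 s₀ lab).Ω 1 ≠ ∅ := by
      rw [σOfRecord_zero_Ω_one]; exact hΩ
    have hT' : slotsTOfRecord F N θ.ν θ.τ9 (EOfRecord₁₃ F N θ.toStage13Params) (wOfRecord₉ F N θ.toStage9Params) θ.ppSel p (gOfRecord₁₃ F N θ.toStage13Params p) 1
        (σOfRecord F θ.ν θ.τ9.M p (gOfRecord₁₃ F N θ.toStage13Params p) 0 s₀ lab) ≠ 0 := by
      rw [slotsTOfRecord₁₃H_one_eq θ p]; exact hT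
    obtain ⟨hnew, hanE, hanR, hanB, hcl⟩ := hp _ hΩ' hT'
    refine ⟨hnew, hanE, hanR, hanB, ?_⟩
    rw [slotsTOfRecord₁₃H_one_eq θ p, sect2Slot_eq_TkOfRecord_sect2Operand] at hcl
    exact hcl.resolve_left hT

/-- **THE FIRST LINK FROM FIRST-STEP DATA IN PRINT's INDEXING**: a supplier whose level-0 response `(u, E₁)` is universal in 𝐄, carries the four 𝐄-clauses at ONE history of
length 1 and the first-step clauses at the LABELLED 𝐓-present children has the first link (p597418's `newEClausesAt_of_universalE` + ★ above); with §4 ★★★ the chain's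
level 1 at the door of record from such DATA is the one-liner `chainFormAt_one_rePinH_doorCured_theta13LiveOfRecord_of_firstLink F N p hK (firstLinkObligations_of_labels _ p hu s₁ h₁ hlab)`.
[cite: Balaban1988Convergent, Thm 2 p.263, §3 pp.264–270, (3.5) p.265, (3.25) p.270, (2.25)–(2.28) p.259; Balaban1987RG1, Thm 1 p.258] -/
theorem firstLinkObligations_of_labels {σ : Sect3Supplier θ p} (hE : Sect2.UniversalE (σ 0 (chainWitness θ p σ 0).1 (chainWitness θ p σ 0).2).1)
    (s₁ : SeqOfRecord F θ.ν θ.τ9.M (gOfRecord₁₃ F N θ.toStage13Params p) p.K 1) (h₁ : NewEClausesAt θ p 0 ((σ 0 (chainWitness θ p σ 0).1 (chainWitness θ p σ 0).2).1 s₁) s₁)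
    (hlab : ∀ (s₀ : SeqOfRecord F θ.ν θ.τ9.M (gOfRecord₁₃ F N θ.toStage13Params p) p.K 0) (lab : LbOfRecord F θ.ν p (gOfRecord₁₃ F N θ.toStage13Params p) 0),
      (σOfRecord F θ.ν θ.τ9.M p (gOfRecord₁₃ F N θ.toStage13Params p) 0 s₀ lab).Ω 1 ≠ ∅ →
      slotsTOfRecord F N θ.ν θ.τ9 (EOfRecord₁₃ F N θ.toStage13Params) (wOfRecord₉ F N θ.toStage9Params) θ.ppSel p (gOfRecord₁₃ F N θ.toStage13Params p) 1
          (σOfRecord F θ.ν θ.τ9.M p (gOfRecord₁₃ F N θ.toStage13Params p) 0 s₀ lab) ≠ 0 →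
      FirstStepClausesAt θ p (σOfRecord F θ.ν θ.τ9.M p (gOfRecord₁₃ F N θ.toStage13Params p) 0 s₀ lab)
        ((σ 0 (chainWitness θ p σ 0).1 (chainWitness θ p σ 0).2).1 (σOfRecord F θ.ν θ.τ9.M p (gOfRecord₁₃ F N θ.toStage13Params p) 0 s₀ lab))
        ((σ 0 (chainWitness θ p σ 0).1 (chainWitness θ p σ 0).2).2 (σOfRecord F θ.ν θ.τ9.M p (gOfRecord₁₃ F N θ.toStage13Params p) 0 s₀ lab))) :
    FirstLinkObligations θ p σ :=
  ⟨hE, newEClausesAt_of_universalE hE h₁, firstStepClauses_present_of_labels θ p _ _ hlab⟩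

end Labels

/-! ## §6 (v1.1). At level 0 dag-n11-d's ∃-deliverable IS the chain's obligation -/

section ZeroIff

variable {F : T4Family} {N : ℕ} [NeZero N]
variable (θ : Stage13HParams F N) (p : B12.RunParams)

/-- ★ **AT LEVEL 0, `NoExpansionTStepAt θ p 0 ↔ NoExpansionClauseFor θ p 0 (base witness)`** (`1 ≤ M`): dag-n11-d's «SOME exposed witness of `ρ₀`'s form carries the 𝐓-clause»
and the chain's «the BASE witness carries it» are the same statement (→ §3 ★★; ← the base witness has the form, `baseWitness_form`).
[cite: Balaban1988Convergent, Theorem p.245, Thm 1 p.262, (3.24)–(3.25) p.270, (2.17)–(2.18) p.257] -/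
theorem noExpansionTStepAt_zero_iff_clauseFor_baseWitness (hM : 1 ≤ θ.τ9.M) :
    NoExpansionTStepAt θ p 0 ↔ NoExpansionClauseFor θ p 0 (baseWitness θ p).1 (baseWitness θ p).2 :=
  ⟨noExpansionClauseFor_zero_baseWitness_of_noExpansionTStepAt θ p hM, fun h _ => ⟨_, _, baseWitness_form θ p, h⟩⟩

end ZeroIff

end Summit.QuantumFields.YangMills.Theorems.BalabanUVNodesN11SupplyChainBaseConstant

end
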